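import Literature.MathematicalPhysics.QuantumManyBody.BoseEinsteinCondensation
import Mathlib.Topology.Connected.LocallyPathConnected
import HarnessLib

/-!
# Crux `GroundStateRigidity` (stmt-AtomisticToContinuum-9072): Theseus from lonely insertion

Supports (does not close) stmt-AtomisticToContinuum-9072. It relates two REGISTERED stub statements of the crux's
skeleton lines by a sorry-free implication:

* the kernel `stub_theseus` of line `PermanentMember` (Cruxes/GroundStateRigidity/Lines/permanent_member.lean):
  at `N b³ ≤ c L³`, a connected component of the labelled free region
  `F_b(N, L) = {X ∈ Λ_L^N : |xᵢ − xⱼ| > b (i ≠ j)}` in which EVERY label is somewhere `2b`-lonely (all other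
  centres farther than `2b`) contains a parked configuration (all pairs `> 2b`);
* the kernel `stub_lonelyInsertion` of line `LonelyInsertion` (Cruxes/GroundStateRigidity/Lines/lonely_insertion.lean):
  at `(n+1) b³ ≤ c L³`, if `Z ∈ F_b(n+1, L)` has a `2b`-lonely label `i` and the frame `Z⁽ⁱ⁾ ∈ F_b(n, L)` (label `i`
  deleted) is principal (its component contains a parked configuration), then `Z` is principal.

**Theorem (`theseus_of_lonelyInsertion`).** Lonely insertion (with constant `c`) implies Theseus (with the same
constant).

## Proof

Induction on the particle number at fixed `(L, b)`; the density hypothesis is inherited downwards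
(`n b³ ≤ (n+1) b³`). For `N = 0` every configuration is parked. For `N = n + 1`: let `K` be the component of `X`
and suppose it contains no parked configuration. By hypothesis label `0` is lonely at some `Z ∈ K`. The deletion
map `π₀ : F_b(n+1, L) → F_b(n, L)` is continuous, so `π₀(K)` lies inside the component `K'` of `π₀(Z)`. If `K'` is
principal, lonely insertion makes `Z` — hence `K` — principal: contradiction. Otherwise the induction hypothesis
(contrapositive) yields a frame label `j` that is lonely NOWHERE in `K'`; but label `succAbove 0 j` is lonely at some
`W ∈ K`, and then `j` is lonely at `π₀(W) ∈ K'` (its partners in the frame are partners in `W`, with the same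
distances) — contradiction. Folklore point-set topology (continuous images of connected sets,
`IsPreconnected.subset_connectedComponentIn`); the combinatorial content is the observation that the never-lonely
labels of a trapped component form a self-trapped sub-frame.
-/

noncomputable section

open Metric Set

namespace Summit.AtomisticToContinuum.BoseEinsteinCondensation.Theorems.GroundStateRigidity

open Literature.MathematicalPhysics.QuantumManyBody.BoseGas

namespace LonelyInsertion

/-- Deleting a label is continuous. [folklore] -/
theorem continuous_del {n : ℕ} (i : Fin (n + 1)) :
    Continuous (fun V : Config (n + 1) => fun j => V (i.succAbove j)) :=
  continuous_pi fun j => continuous_apply (i.succAbove j)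

/-- Deleting a label maps the free region of `n+1` spheres into the free region of `n` spheres. [folklore] -/
theorem del_mem_free {n : ℕ} {L b : ℝ} (i : Fin (n + 1)) {V : Config (n + 1)}
    (hV : V ∈ {Z : Config (n + 1) | Z ∈ boxN (n + 1) L ∧ ∀ i j : Fin (n + 1), i ≠ j → b < dist (Z i) (Z j)}) :
    (fun j => V (i.succAbove j)) ∈ {Z : Config n | Z ∈ boxN n L ∧ ∀ i j : Fin n, i ≠ j → b < dist (Z i) (Z j)} := by
  refine ⟨fun j => hV.1 (i.succAbove j), fun j k hjk => ?_⟩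
  exact hV.2 _ _ (fun h => hjk (Fin.succAbove_right_injective h))

/-- Deleting a label maps the connected component of `X` in the free region of `n+1` spheres into the connected
component of the reduced configuration in the free region of `n` spheres (continuous image of a connected set).
[folklore] -/
theorem del_mem_connectedComponentIn {n : ℕ} {L b : ℝ} (i : Fin (n + 1)) {X W : Config (n + 1)}
    (hX : X ∈ {Z : Config (n + 1) | Z ∈ boxN (n + 1) L ∧ ∀ i j : Fin (n + 1), i ≠ j → b < dist (Z i) (Z j)})
    (hW : W ∈ connectedComponentIn
      {Z : Config (n + 1) | Z ∈ boxN (n + 1) L ∧ ∀ i j : Fin (n + 1), i ≠ j → b < dist (Z i) (Z j)} X) :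
    (fun j => W (i.succAbove j)) ∈ connectedComponentIn
      {Z : Config n | Z ∈ boxN n L ∧ ∀ i j : Fin n, i ≠ j → b < dist (Z i) (Z j)}
      (fun j => X (i.succAbove j)) := by
  have hpre : IsPreconnected ((fun V : Config (n + 1) => fun j => V (i.succAbove j)) '' connectedComponentIn
      {Z : Config (n + 1) | Z ∈ boxN (n + 1) L ∧ ∀ i j : Fin (n + 1), i ≠ j → b < dist (Z i) (Z j)} X) :=
    isPreconnected_connectedComponentIn.image _ (continuous_del i).continuousOn
  have hsub : (fun V : Config (n + 1) => fun j => V (i.succAbove j)) '' connectedComponentIn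
      {Z : Config (n + 1) | Z ∈ boxN (n + 1) L ∧ ∀ i j : Fin (n + 1), i ≠ j → b < dist (Z i) (Z j)} X ⊆
      {Z : Config n | Z ∈ boxN n L ∧ ∀ i j : Fin n, i ≠ j → b < dist (Z i) (Z j)} := by
    rintro _ ⟨V, hV, rfl⟩
    exact del_mem_free i (connectedComponentIn_subset _ _ hV)
  exact hpre.subset_connectedComponentIn (Set.mem_image_of_mem _ (mem_connectedComponentIn hX)) hsub
    (Set.mem_image_of_mem _ hW)

/-- **Theseus from lonely insertion.** If lonely insertion preserves principality (Stub E\*), then at the same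
density constant every component of the free region in which every label is somewhere `2b`-lonely contains a parked
configuration — verbatim the statement of `PermanentMember.stub_theseus`. Induction on the number of particles at
fixed `(L, b)`: delete a lonely label; either the frame is principal (then E\* applies) or, by induction, the frame
has a label that is never lonely in the frame's component, and that label is then never lonely in the original
component (the deletion map is continuous, so it maps the component into the frame's component). [folklore] -/
theorem theseus_of_lonelyInsertion
    (hLI :
    ∃ c : ℝ, 0 < c ∧ ∀ (n : ℕ) (L b : ℝ), 0 < b → ((n + 1 : ℕ) : ℝ) * b ^ 3 ≤ c * L ^ 3 →
        ∀ Z ∈ {W : Config (n + 1) | W ∈ boxN (n + 1) L ∧ ∀ i j : Fin (n + 1), i ≠ j → b < dist (W i) (W j)},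
        ∀ i : Fin (n + 1),
          (∀ j : Fin (n + 1), j ≠ i → 2 * b < dist (Z i) (Z j)) →
          (∃ Y' ∈ connectedComponentIn
              {W : Config n | W ∈ boxN n L ∧ ∀ i j : Fin n, i ≠ j → b < dist (W i) (W j)}
              (fun j => Z (i.succAbove j)),
            ∀ j k : Fin n, j ≠ k → 2 * b < dist (Y' j) (Y' k)) →
          ∃ Y ∈ connectedComponentIn
              {W : Config (n + 1) | W ∈ boxN (n + 1) L ∧ ∀ i j : Fin (n + 1), i ≠ j → b < dist (W i) (W j)} Z,
            ∀ j k : Fin (n + 1), j ≠ k → 2 * b < dist (Y j) (Y k)) :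
    ∃ c₂ : ℝ, 0 < c₂ ∧ ∀ (N : ℕ) (L b : ℝ), 0 < b → (N : ℝ) * b ^ 3 ≤ c₂ * L ^ 3 →
      ∀ X ∈ {Z : Config N | Z ∈ boxN N L ∧ ∀ i j : Fin N, i ≠ j → b < dist (Z i) (Z j)},
        (∀ i : Fin N, ∃ Y ∈ connectedComponentIn
            {Z : Config N | Z ∈ boxN N L ∧ ∀ i j : Fin N, i ≠ j → b < dist (Z i) (Z j)} X,
          ∀ j : Fin N, j ≠ i → 2 * b < dist (Y i) (Y j)) →
        ∃ Y ∈ connectedComponentIn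
            {Z : Config N | Z ∈ boxN N L ∧ ∀ i j : Fin N, i ≠ j → b < dist (Z i) (Z j)} X,
          ∀ i j : Fin N, i ≠ j → 2 * b < dist (Y i) (Y j) := by
  obtain ⟨c, hc, hli⟩ := hLI
  refine ⟨c, hc, ?_⟩
  intro N
  induction N with
  | zero =>
    intro L b _ _ X hX _
    exact ⟨X, mem_connectedComponentIn hX, fun i => i.elim0⟩
  | succ n ih =>
    intro L b hb hNb X hX hlonely
    by_contra hnot
    -- the density hypothesis is inherited by the frame
    have hnb : (n : ℝ) * b ^ 3 ≤ c * L ^ 3 := by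
      have h1 : (n : ℝ) ≤ ((n + 1 : ℕ) : ℝ) := by exact_mod_cast Nat.le_succ n
      have hb3 : 0 ≤ b ^ 3 := by positivity
      exact (mul_le_mul_of_nonneg_right h1 hb3).trans hNb
    -- a configuration of the component at which label `0` is lonely
    obtain ⟨Z, hZ, hZl⟩ := hlonely 0
    have hZf := connectedComponentIn_subset _ _ hZ
    have hcomp := connectedComponentIn_eq hZ
    by_cases hP : ∃ Y' ∈ connectedComponentIn
        {Z : Config n | Z ∈ boxN n L ∧ ∀ i j : Fin n, i ≠ j → b < dist (Z i) (Z j)}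
        (fun j => Z ((0 : Fin (n + 1)).succAbove j)), ∀ j k : Fin n, j ≠ k → 2 * b < dist (Y' j) (Y' k)
    · -- the frame is principal: lonely insertion makes `Z`, hence the component of `X`, principal
      obtain ⟨Y, hY, hYp⟩ := hli n L b hb hNb Z hZf 0 hZl hP
      exact hnot ⟨Y, by rw [hcomp]; exact hY, hYp⟩
    · -- the frame is not principal: by induction some frame label is never lonely in the frame's component
      have hih := ih L b hb hnb (fun j => Z ((0 : Fin (n + 1)).succAbove j)) (del_mem_free 0 hZf)
      have hnl : ¬ ∀ j : Fin n, ∃ Y' ∈ connectedComponentIn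
          {Z : Config n | Z ∈ boxN n L ∧ ∀ i j : Fin n, i ≠ j → b < dist (Z i) (Z j)}
          (fun j => Z ((0 : Fin (n + 1)).succAbove j)), ∀ k : Fin n, k ≠ j → 2 * b < dist (Y' j) (Y' k) :=
        fun h => hP (hih h)
      push Not at hnl
      obtain ⟨j, hj⟩ := hnl
      -- but the corresponding label of the big system is lonely somewhere in the component of `X`
      obtain ⟨W, hW, hWl⟩ := hlonely ((0 : Fin (n + 1)).succAbove j)
      have hW' := del_mem_connectedComponentIn 0 hZf (by rw [← hcomp]; exact hW)
      obtain ⟨k, hkj, hk⟩ := hj _ hW'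
      have hne : (0 : Fin (n + 1)).succAbove k ≠ (0 : Fin (n + 1)).succAbove j :=
        fun h => hkj (Fin.succAbove_right_injective h)
      exact (not_le.2 (hWl _ hne)) hk

end LonelyInsertion

end Summit.AtomisticToContinuum.BoseEinsteinCondensation.Theorems.GroundStateRigidity

end
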